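import Summits.Ventures.Crystal3D.Theorems.StickyWulffConstantCoaxialWallLawOneFccCoreLemmas
import Summits.Ventures.Crystal3D.Theorems.StickyWulffConstantCoaxialWallLawOneFccFluxF
import Summits.Ventures.Crystal3D.Theorems.StickyWulffConstantCoaxialWallLawOneFccFluxC
import HarnessLib

/-!
# The ONE-FCC F_layer: the three COUNTS in the ledger's coordinates (file (k₂))

HONEST FRAMING. Venture `Summits/Ventures/Crystal3D` (cell `crystal3d-full`); helper `--supports` the crux `CoaxialWallLaw`
(stmt-Ventures-19481, REGISTERED line `WallLedgerF`) in its role as owner of lane T's debt T-F2 / F_layer, OneFcc half (cf-p1 (civ)/(cxx);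
memo HOME/wall-19481-p1/g16/TWO-FAMILY-LEDGER-g16.md).  Rewrites `oneFcc_srcA_ge` / `oneFcc_exitB_le` / `oneFcc_srcB_ge` (…OneFccFluxF/C)
into the exact hypothesis shapes (I1)–(I3) of `oneFcc_ledger` (…OneFccLedger): one line density
`Φ = 4 (Σ_{r ∈ RT(Fr)} (Fr r)₂)/(√3 (1 − ν₂²))`, one tilt `ν₂ = (L⁻¹ e₃)₂` of the FAULTED plate `(L, s)`, one arithmetic progression
`x₀ + k d + ψ`, `x₀ = (L⁻¹ s)₂ − z ν₂` (slice height `z`), `ψ = (z + R₀ + 2) ν₂`, radius `ρ − 4`, per-plane constant `3` (paid `9·#K`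
for `#RT ≤ 12`).  Census-free, standard axioms; nothing about the crux is claimed; F-C1 not moved.

* `oneFcc_srcA_ledger` — (I1) `Σ_k wA_k (Φ G_k − 3) ≤ srcA + 9 #K`;
* `mirrorCell_separated`, `oneFcc_exitB_ledger` — (I3) `exitB ≤ Σ_k (1 − wN_k)(Φ G_k + 3) + 9 #K + 1728 ρ` (mirrored cell, `K` holding
  every layer met by the cell);
* `oneFcc_srcB_ledger` — (I2) `∃ ψ', |ψ' − ψ| ≤ d ∧ Σ_k (Φ G(x₀ + k d + ψ') − 3) ≤ srcB + 9 #K` (the fcc plate re-presented by `FrB`).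
WHAT THIS IS NOT: the charge (file (j)), the ledger, the assembly; F-C1 not moved.
-/

noncomputable section

namespace Summit.Ventures.Crystal3D.Theorems

open Summit.Ventures.Crystal3D Finset
open Literature.MathematicalPhysics.StatisticalMechanics (IsHaggSeq basalMirror basalMirror_apply_coord basalMirror_basalMirror
  barlowPos barlowStacking barlowPos_mem constHagg)
open Summit.Ventures.Crystal3D.Cruxes.TextureLiminf.TexShadow (E3 stacking)
open scoped InnerProductSpace

open scoped Classical in
/-- **(I1) in the ledger's coordinates.** -/
theorem oneFcc_srcA_ledger {σ : ℤ → ℤ} (L : E3 ≃ₗᵢ[ℝ] E3) (s : E3) (Fr : E3 ≃ₗᵢ[ℝ] E3) {t : ℤ}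
    (hFr : (t = 1 ∧ Fr = L) ∨ (t = -1 ∧ Fr = basalMirror.trans L))
    (P₁ : Finset E3) (R₀ h ρ zs : ℝ) (hR₀ : 3 ≤ R₀) (hh : 0 ≤ h) (hρ : 4 ≤ ρ)
    (hP₁ : ∀ p, p ∈ P₁ ↔ (p ∈ stacking L s σ ∧ -(2 * R₀) ≤ p 2 ∧ p 2 ≤ -R₀ ∧ p 0 ^ 2 + p 1 ^ 2 ≤ ρ ^ 2))
    (Kw : Finset ℤ) :
    ∑ k ∈ Kw, (if ¬ (σ (k - 1) = -t ∧ σ k = -t) then (1 : ℝ) else 0) *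
        (4 * (∑ r ∈ inPlaneRoots Fr 1, (Fr r) 2) / (Real.sqrt 3 * (1 - (L.symm (EuclideanSpace.single (2 : Fin 3) (1 : ℝ))) 2 ^ 2)) *
          Real.sqrt (max 0 ((ρ - 4) ^ 2 * (1 - (L.symm (EuclideanSpace.single (2 : Fin 3) (1 : ℝ))) 2 ^ 2) -
            ((L.symm s) 2 - zs * (L.symm (EuclideanSpace.single (2 : Fin 3) (1 : ℝ))) 2 + (k : ℝ) * Real.sqrt (2 / 3) +
              (zs + R₀ + 2) * (L.symm (EuclideanSpace.single (2 : Fin 3) (1 : ℝ))) 2) ^ 2)) - 3) ≤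
      ((∑ r ∈ inPlaneRoots Fr 1,
        ((P₁.filter fun p => -(R₀ + 1) - 1 - 1 ≤ p 2 ∧ p 2 ≤ -(R₀ + 1) - 1 ∧ p 0 ^ 2 + p 1 ^ 2 ≤ (ρ - 1 - 1) ^ 2).filter
          fun p => (∃ k i j : ℤ, p = L (barlowPos 1 (Real.sqrt (2 / 3)) σ k i j) + s ∧ ¬ (σ (k - 1) = -t ∧ σ k = -t)) ∧
            -(R₀ + 1) - 1 < (p + Fr r) 2 ∧ (p + Fr r) 2 < h + (R₀ + 1) + 1).card : ℕ) : ℝ) +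
      9 * (Kw.card : ℝ) := by
  have h0 := oneFcc_srcA_ge L s Fr (fun r hr => frame_apply_basal hFr hr) t P₁ R₀ h ρ hR₀ hh hρ hP₁ Kw
  have harg : ∀ k : ℤ, (k : ℝ) * Real.sqrt (2 / 3) + (L.symm s) 2 -
      (-(R₀ + 1) - 1) * (L.symm (EuclideanSpace.single (2 : Fin 3) (1 : ℝ))) 2 =
      (L.symm s) 2 - zs * (L.symm (EuclideanSpace.single (2 : Fin 3) (1 : ℝ))) 2 + (k : ℝ) * Real.sqrt (2 / 3) +
        (zs + R₀ + 2) * (L.symm (EuclideanSpace.single (2 : Fin 3) (1 : ℝ))) 2 := fun k => by ring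
  simp only [harg] at h0
  have hRT : ((inPlaneRoots Fr 1).card : ℝ) ≤ 12 := by
    have : (inPlaneRoots Fr 1).card ≤ 12 := (card_le_card (filter_subset _ _)).trans (by rw [card_fccSlots])
    exact_mod_cast this
  have hw01 : ∀ k : ℤ, 0 ≤ (if ¬ (σ (k - 1) = -t ∧ σ k = -t) then (1 : ℝ) else 0) ∧
      (if ¬ (σ (k - 1) = -t ∧ σ k = -t) then (1 : ℝ) else 0) ≤ 1 := fun k => by
    split_ifs <;> norm_num
  have hsplit := h0
  rw [← sub_nonneg] at hsplit ⊢
  have hextra : ∑ k ∈ Kw, (if ¬ (σ (k - 1) = -t ∧ σ k = -t) then (1 : ℝ) else 0) * (((inPlaneRoots Fr 1).card : ℝ) - 3) ≤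
      9 * (Kw.card : ℝ) := by
    calc ∑ k ∈ Kw, (if ¬ (σ (k - 1) = -t ∧ σ k = -t) then (1 : ℝ) else 0) * (((inPlaneRoots Fr 1).card : ℝ) - 3)
        ≤ ∑ k ∈ Kw, (9 : ℝ) := sum_le_sum fun k _ => by nlinarith [(hw01 k).1, (hw01 k).2, hRT]
      _ = 9 * (Kw.card : ℝ) := by rw [sum_const, nsmul_eq_mul, mul_comm]
  have hid : ∀ k : ℤ, ∀ (w Φg c : ℝ), w * (Φg - 3) = w * (Φg - c) + w * (c - 3) := fun k w Φg c => by ring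
  have key : ∑ k ∈ Kw, (if ¬ (σ (k - 1) = -t ∧ σ k = -t) then (1 : ℝ) else 0) *
        (4 * (∑ r ∈ inPlaneRoots Fr 1, (Fr r) 2) / (Real.sqrt 3 * (1 - (L.symm (EuclideanSpace.single (2 : Fin 3) (1 : ℝ))) 2 ^ 2)) *
          Real.sqrt (max 0 ((ρ - 4) ^ 2 * (1 - (L.symm (EuclideanSpace.single (2 : Fin 3) (1 : ℝ))) 2 ^ 2) -
            ((L.symm s) 2 - zs * (L.symm (EuclideanSpace.single (2 : Fin 3) (1 : ℝ))) 2 + (k : ℝ) * Real.sqrt (2 / 3) +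
              (zs + R₀ + 2) * (L.symm (EuclideanSpace.single (2 : Fin 3) (1 : ℝ))) 2) ^ 2)) - 3) =
      ∑ k ∈ Kw, (if ¬ (σ (k - 1) = -t ∧ σ k = -t) then (1 : ℝ) else 0) *
        (4 * (∑ r ∈ inPlaneRoots Fr 1, (Fr r) 2) / (Real.sqrt 3 * (1 - (L.symm (EuclideanSpace.single (2 : Fin 3) (1 : ℝ))) 2 ^ 2)) *
          Real.sqrt (max 0 ((ρ - 4) ^ 2 * (1 - (L.symm (EuclideanSpace.single (2 : Fin 3) (1 : ℝ))) 2 ^ 2) -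
            ((L.symm s) 2 - zs * (L.symm (EuclideanSpace.single (2 : Fin 3) (1 : ℝ))) 2 + (k : ℝ) * Real.sqrt (2 / 3) +
              (zs + R₀ + 2) * (L.symm (EuclideanSpace.single (2 : Fin 3) (1 : ℝ))) 2) ^ 2)) - ((inPlaneRoots Fr 1).card : ℝ)) +
      ∑ k ∈ Kw, (if ¬ (σ (k - 1) = -t ∧ σ k = -t) then (1 : ℝ) else 0) * (((inPlaneRoots Fr 1).card : ℝ) - 3) := by
    rw [← sum_add_distrib]
    exact sum_congr rfl fun k _ => by ring
  nlinarith [key, hextra, hsplit]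

/-- The mirrored cell is `1`-separated. -/
theorem mirrorCell_separated (Y : Finset E3) (hY : ∀ p ∈ Y, ∀ q ∈ Y, p ≠ q → 1 ≤ dist p q) (c : E3) :
    ∀ p ∈ Y.image (fun p => basalMirror p + c), ∀ q ∈ Y.image (fun p => basalMirror p + c), p ≠ q → 1 ≤ dist p q := by
  intro p hp q hq hpq
  obtain ⟨p', hp', rfl⟩ := mem_image.1 hp
  obtain ⟨q', hq', rfl⟩ := mem_image.1 hq
  have hne : p' ≠ q' := fun h => hpq (by rw [h])
  have := hY p' hp' q' hq' hne
  rwa [dist_add_right, LinearIsometryEquiv.dist_map]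

open scoped Classical in
/-- **(I3) in the ledger's coordinates.** -/
theorem oneFcc_exitB_ledger {σ : ℤ → ℤ} (L : E3 ≃ₗᵢ[ℝ] E3) (s : E3) (Fr : E3 ≃ₗᵢ[ℝ] E3) {t : ℤ}
    (hFr : (t = 1 ∧ Fr = L) ∨ (t = -1 ∧ Fr = basalMirror.trans L))
    (Y : Finset E3) (R₀ h ρ zs : ℝ) (hρ : 6 ≤ ρ) (hY : ∀ p ∈ Y, ∀ q ∈ Y, p ≠ q → 1 ≤ dist p q)
    (Kw : Finset ℤ)
    (hKw : ∀ k i j : ℤ, (L.trans basalMirror) (barlowPos 1 (Real.sqrt (2 / 3)) σ k i j) +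
      (basalMirror s + h • EuclideanSpace.single (2 : Fin 3) (1 : ℝ)) ∈
        Y.image (fun p => basalMirror p + h • EuclideanSpace.single (2 : Fin 3) (1 : ℝ)) → k ∈ Kw) :
    ((∑ r ∈ inPlaneRoots ((((ℝ ∙ EuclideanSpace.single (2 : Fin 3) (1 : ℝ)).reflection).trans Fr).trans basalMirror) 1,
        ((Y.image fun p => basalMirror p + h • EuclideanSpace.single (2 : Fin 3) (1 : ℝ)).filter fun b =>
          h + (R₀ + 1) + 1 ≤ b 2 ∧ b 2 ≤ h + (R₀ + 1) + 1 + 1 ∧ b 0 ^ 2 + b 1 ^ 2 ≤ (ρ - 1 - 2) ^ 2 ∧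
          (b - ((((ℝ ∙ EuclideanSpace.single (2 : Fin 3) (1 : ℝ)).reflection).trans Fr).trans basalMirror) r) 2 < h + (R₀ + 1) + 1 ∧
          ∃ k i j : ℤ, b = (L.trans basalMirror) (barlowPos 1 (Real.sqrt (2 / 3)) σ k i j) +
              (basalMirror s + h • EuclideanSpace.single (2 : Fin 3) (1 : ℝ)) ∧
            ¬ (σ (k - 1) = t ∧ σ k = t)).card : ℕ) : ℝ) ≤
      ∑ k ∈ Kw, (1 - (if (σ (k - 1) = t ∧ σ k = t) then (1 : ℝ) else 0)) *
        (4 * (∑ r ∈ inPlaneRoots Fr 1, (Fr r) 2) / (Real.sqrt 3 * (1 - (L.symm (EuclideanSpace.single (2 : Fin 3) (1 : ℝ))) 2 ^ 2)) *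
          Real.sqrt (max 0 ((ρ - 4) ^ 2 * (1 - (L.symm (EuclideanSpace.single (2 : Fin 3) (1 : ℝ))) 2 ^ 2) -
            ((L.symm s) 2 - zs * (L.symm (EuclideanSpace.single (2 : Fin 3) (1 : ℝ))) 2 + (k : ℝ) * Real.sqrt (2 / 3) +
              (zs + R₀ + 2) * (L.symm (EuclideanSpace.single (2 : Fin 3) (1 : ℝ))) 2) ^ 2)) + 3) +
      (9 * (Kw.card : ℝ) + 1728 * ρ) := by
  have hFrL : ∀ r : E3, r 2 = 0 → Fr r = L r := fun r hr => frame_apply_basal hFr hr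
  have hY' := mirrorCell_separated Y hY (h • EuclideanSpace.single (2 : Fin 3) (1 : ℝ))
  have h0 := oneFcc_exitB_le (L.trans basalMirror) (basalMirror s + h • EuclideanSpace.single (2 : Fin 3) (1 : ℝ))
    ((((ℝ ∙ EuclideanSpace.single (2 : Fin 3) (1 : ℝ)).reflection).trans Fr).trans basalMirror) (fun r hr => frB_apply_basal hFrL hr)
    t (Y.image fun p => basalMirror p + h • EuclideanSpace.single (2 : Fin 3) (1 : ℝ)) R₀ h ρ hρ hY' Kw hKw
  -- the roots and rises of `FrB` are those of `Fr`
  rw [inPlaneRoots_frB hFrL] at h0 ⊢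
  have hα : ∑ r ∈ inPlaneRoots Fr 1, (((((ℝ ∙ EuclideanSpace.single (2 : Fin 3) (1 : ℝ)).reflection).trans Fr).trans basalMirror) r) 2 =
      ∑ r ∈ inPlaneRoots Fr 1, (Fr r) 2 :=
    sum_congr rfl fun r hr => frB_apply_two hFrL (mem_filter.1 hr).2.1
  rw [hα, symm_e₃_two_trans_basalMirror, symm_two_trans_basalMirror_shift, neg_sq] at h0
  have harg : ∀ k : ℤ, (k : ℝ) * Real.sqrt (2 / 3) + ((L.symm s) 2 - h * (L.symm (EuclideanSpace.single (2 : Fin 3) (1 : ℝ))) 2) -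
      (h + (R₀ + 1) + 1) * -(L.symm (EuclideanSpace.single (2 : Fin 3) (1 : ℝ))) 2 =
      (L.symm s) 2 - zs * (L.symm (EuclideanSpace.single (2 : Fin 3) (1 : ℝ))) 2 + (k : ℝ) * Real.sqrt (2 / 3) +
        (zs + R₀ + 2) * (L.symm (EuclideanSpace.single (2 : Fin 3) (1 : ℝ))) 2 := fun k => by ring
  have hrad : ρ - 5 + 1 = ρ - 4 := by ring
  simp only [harg, hrad, ite_not_one_zero] at h0
  -- the per-plane constant
  have hRT : ((inPlaneRoots Fr 1).card : ℝ) ≤ 12 := by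
    have : (inPlaneRoots Fr 1).card ≤ 12 := (card_le_card (filter_subset _ _)).trans (by rw [card_fccSlots])
    exact_mod_cast this
  have hw01 : ∀ k : ℤ, 0 ≤ (1 - (if (σ (k - 1) = t ∧ σ k = t) then (1 : ℝ) else 0)) ∧
      (1 - (if (σ (k - 1) = t ∧ σ k = t) then (1 : ℝ) else 0)) ≤ 1 := fun k => by
    split_ifs <;> norm_num
  have hextra : ∑ k ∈ Kw, (1 - (if (σ (k - 1) = t ∧ σ k = t) then (1 : ℝ) else 0)) * (((inPlaneRoots Fr 1).card : ℝ) - 3) ≤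
      9 * (Kw.card : ℝ) := by
    calc ∑ k ∈ Kw, (1 - (if (σ (k - 1) = t ∧ σ k = t) then (1 : ℝ) else 0)) * (((inPlaneRoots Fr 1).card : ℝ) - 3)
        ≤ ∑ k ∈ Kw, (9 : ℝ) := sum_le_sum fun k _ => by nlinarith [(hw01 k).1, (hw01 k).2, hRT]
      _ = 9 * (Kw.card : ℝ) := by rw [sum_const, nsmul_eq_mul, mul_comm]
  have key : ∑ k ∈ Kw, (1 - (if (σ (k - 1) = t ∧ σ k = t) then (1 : ℝ) else 0)) *
        (4 * (∑ r ∈ inPlaneRoots Fr 1, (Fr r) 2) / (Real.sqrt 3 * (1 - (L.symm (EuclideanSpace.single (2 : Fin 3) (1 : ℝ))) 2 ^ 2)) *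
          Real.sqrt (max 0 ((ρ - 4) ^ 2 * (1 - (L.symm (EuclideanSpace.single (2 : Fin 3) (1 : ℝ))) 2 ^ 2) -
            ((L.symm s) 2 - zs * (L.symm (EuclideanSpace.single (2 : Fin 3) (1 : ℝ))) 2 + (k : ℝ) * Real.sqrt (2 / 3) +
              (zs + R₀ + 2) * (L.symm (EuclideanSpace.single (2 : Fin 3) (1 : ℝ))) 2) ^ 2)) +
          ((inPlaneRoots Fr 1).card : ℝ)) =
      ∑ k ∈ Kw, (1 - (if (σ (k - 1) = t ∧ σ k = t) then (1 : ℝ) else 0)) *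
        (4 * (∑ r ∈ inPlaneRoots Fr 1, (Fr r) 2) / (Real.sqrt 3 * (1 - (L.symm (EuclideanSpace.single (2 : Fin 3) (1 : ℝ))) 2 ^ 2)) *
          Real.sqrt (max 0 ((ρ - 4) ^ 2 * (1 - (L.symm (EuclideanSpace.single (2 : Fin 3) (1 : ℝ))) 2 ^ 2) -
            ((L.symm s) 2 - zs * (L.symm (EuclideanSpace.single (2 : Fin 3) (1 : ℝ))) 2 + (k : ℝ) * Real.sqrt (2 / 3) +
              (zs + R₀ + 2) * (L.symm (EuclideanSpace.single (2 : Fin 3) (1 : ℝ))) 2) ^ 2)) + 3) +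
      ∑ k ∈ Kw, (1 - (if (σ (k - 1) = t ∧ σ k = t) then (1 : ℝ) else 0)) * (((inPlaneRoots Fr 1).card : ℝ) - 3) := by
    rw [← sum_add_distrib]
    exact sum_congr rfl fun k _ => by ring
  have h12 : ((inPlaneRoots Fr 1).card : ℝ) * (144 * ρ) ≤ 1728 * ρ := by nlinarith
  linarith [key, hextra, h0, h12]

open scoped Classical in
/-- **(I2) in the ledger's coordinates.** -/
theorem oneFcc_srcB_ledger {σ₂ : ℤ → ℤ} (L L₂ : E3 ≃ₗᵢ[ℝ] E3) (s s₂ : E3) (Fr : E3 ≃ₗᵢ[ℝ] E3) {t : ℤ}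
    (hFr : (t = 1 ∧ Fr = L) ∨ (t = -1 ∧ Fr = basalMirror.trans L))
    (Gf : E3 ≃ₗᵢ[ℝ] E3) {ε : ℤ} (hGf : (ε = 1 ∧ Gf = L₂) ∨ (ε = -1 ∧ Gf = basalMirror.trans L₂))
    (hσ₂ : ∀ n : ℤ, σ₂ n = ε)
    (hdozen : (Gf : E3 → E3) '' ↑fccSlots = (fun x => Fr (basalMirror x)) '' ↑fccSlots)
    (P₂ : Finset E3) (R₀ h ρ zs : ℝ) (hR₀ : 3 ≤ R₀) (hh : 0 ≤ h) (hρ : 4 ≤ ρ)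
    (hP₂ : ∀ p, p ∈ P₂ ↔ (p ∈ stacking L₂ s₂ σ₂ ∧ h + R₀ ≤ p 2 ∧ p 2 ≤ h + 2 * R₀ ∧ p 0 ^ 2 + p 1 ^ 2 ≤ ρ ^ 2))
    (Kw : Finset ℤ) :
    ∃ ψ' : ℝ, |ψ' - (zs + R₀ + 2) * (L.symm (EuclideanSpace.single (2 : Fin 3) (1 : ℝ))) 2| ≤ Real.sqrt (2 / 3) ∧
      ∑ k ∈ Kw, (4 * (∑ r ∈ inPlaneRoots Fr 1, (Fr r) 2) /
            (Real.sqrt 3 * (1 - (L.symm (EuclideanSpace.single (2 : Fin 3) (1 : ℝ))) 2 ^ 2)) *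
          Real.sqrt (max 0 ((ρ - 4) ^ 2 * (1 - (L.symm (EuclideanSpace.single (2 : Fin 3) (1 : ℝ))) 2 ^ 2) -
            ((L.symm s) 2 - zs * (L.symm (EuclideanSpace.single (2 : Fin 3) (1 : ℝ))) 2 + (k : ℝ) * Real.sqrt (2 / 3) + ψ') ^ 2)) - 3) ≤
      ((∑ r ∈ inPlaneRoots ((((ℝ ∙ EuclideanSpace.single (2 : Fin 3) (1 : ℝ)).reflection).trans Fr).trans basalMirror) 1,
        (((P₂.image fun p => basalMirror p + h • EuclideanSpace.single (2 : Fin 3) (1 : ℝ)).filter fun p =>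
            -(R₀ + 1) - 1 - 1 ≤ p 2 ∧ p 2 ≤ -(R₀ + 1) - 1 ∧ p 0 ^ 2 + p 1 ^ 2 ≤ (ρ - 1 - 1) ^ 2).filter
          fun p => -(R₀ + 1) - 1 < (p + ((((ℝ ∙ EuclideanSpace.single (2 : Fin 3) (1 : ℝ)).reflection).trans Fr).trans basalMirror) r) 2 ∧
            (p + ((((ℝ ∙ EuclideanSpace.single (2 : Fin 3) (1 : ℝ)).reflection).trans Fr).trans basalMirror) r) 2 <
              h + (R₀ + 1) + 1).card : ℕ) : ℝ) +
      9 * (Kw.card : ℝ) := by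
  obtain ⟨H, hH⟩ : ∃ H : E3 ≃ₗᵢ[ℝ] E3, H = (ℝ ∙ EuclideanSpace.single (2 : Fin 3) (1 : ℝ)).reflection := ⟨_, rfl⟩
  obtain ⟨FrB, hFrB⟩ : ∃ FrB : E3 ≃ₗᵢ[ℝ] E3, FrB = (H.trans Fr).trans basalMirror := ⟨_, rfl⟩
  rw [← hH, ← hFrB]
  set cM : E3 := h • EuclideanSpace.single (2 : Fin 3) (1 : ℝ) with hcM
  have hFrL : ∀ r : E3, r 2 = 0 → Fr r = L r := fun r hr => frame_apply_basal hFr hr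
  -- the cell mirror (only what is needed here)
  have hbM : ∀ (v : E3), basalMirror v 0 = v 0 ∧ basalMirror v 1 = v 1 ∧ basalMirror v 2 = -v 2 := fun v =>
    ⟨by rw [basalMirror_apply_coord]; exact if_neg (by decide), by rw [basalMirror_apply_coord]; exact if_neg (by decide),
      by rw [basalMirror_apply_coord, if_pos rfl]⟩
  have hc0 : cM 0 = 0 := by simp [hcM]
  have hc1 : cM 1 = 0 := by simp [hcM]
  have hc2 : cM 2 = h := by simp [hcM]
  have hcMmirror : basalMirror cM = -cM := by
    ext l
    rw [PiLp.neg_apply]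
    fin_cases l
    · simp only [Fin.zero_eta, Fin.isValue]; rw [(hbM cM).1, hc0, neg_zero]
    · simp only [Fin.mk_one, Fin.isValue]; rw [(hbM cM).2.1, hc1, neg_zero]
    · simp only [Fin.reduceFinMk, Fin.isValue]; rw [(hbM cM).2.2]
  set M : E3 → E3 := fun p => basalMirror p + cM with hM
  have hMM : ∀ p, M (M p) = p := by
    intro p; simp only [hM, map_add, basalMirror_basalMirror, hcMmirror]; abel
  have hM2 : ∀ p, M p 2 = h - p 2 := by intro p; simp only [hM, PiLp.add_apply, (hbM p).2.2, hc2]; ring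
  have hMrad : ∀ p, M p 0 ^ 2 + M p 1 ^ 2 = p 0 ^ 2 + p 1 ^ 2 := by
    intro p; simp only [hM, PiLp.add_apply, (hbM p).1, (hbM p).2.1, hc0, hc1, add_zero]
  have hstack : ∀ p : E3, M p ∈ stacking L₂ s₂ σ₂ ↔ p ∈ stacking (L₂.trans basalMirror) (basalMirror s₂ + cM) σ₂ := by
    intro p
    simp only [stacking, Set.mem_image, LinearIsometryEquiv.trans_apply]
    constructor
    · rintro ⟨r, hr, hrp⟩
      refine ⟨r, hr, ?_⟩
      have h1 := congrArg M hrp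
      rw [hMM] at h1
      rw [← h1]; simp only [hM, map_add]; abel
    · rintro ⟨r, hr, rfl⟩
      refine ⟨r, hr, ?_⟩
      simp only [hM, map_add, basalMirror_basalMirror, hcMmirror]; abel
  -- the frames
  have hHneg : ∀ x : E3, H x = -basalMirror x := by
    intro x
    obtain ⟨h0, h1, h2⟩ := halfTurn_coord x
    ext l
    rw [PiLp.neg_apply]
    fin_cases l
    · simp only [Fin.zero_eta, Fin.isValue]; rw [hH, h0, (hbM x).1]
    · simp only [Fin.mk_one, Fin.isValue]; rw [hH, h1, (hbM x).2.1]
    · simp only [Fin.reduceFinMk, Fin.isValue]; rw [hH, h2, (hbM x).2.2, neg_neg]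
  have hnegD : (fun w : E3 => -w) '' (↑fccSlots : Set E3) = ↑fccSlots := by
    ext y
    constructor
    · rintro ⟨w, hw, rfl⟩; exact Finset.mem_coe.2 (neg_mem_fccSlots (Finset.mem_coe.1 hw))
    · intro hy; exact ⟨-y, Finset.mem_coe.2 (neg_mem_fccSlots (Finset.mem_coe.1 hy)), neg_neg y⟩
  have hHD : (H : E3 → E3) '' ↑fccSlots = (basalMirror : E3 → E3) '' ↑fccSlots := by
    have hHfun : (H : E3 → E3) = basalMirror ∘ fun w : E3 => -w :=
      funext fun x => by rw [Function.comp_apply, map_neg, hHneg]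
    rw [hHfun, Set.image_comp, hnegD]
  have hGf' : (ε = 1 ∧ Gf.trans basalMirror = L₂.trans basalMirror) ∨
      (ε = -1 ∧ Gf.trans basalMirror = basalMirror.trans (L₂.trans basalMirror)) := by
    rcases hGf with ⟨h1, h2⟩ | ⟨h1, h2⟩
    · exact Or.inl ⟨h1, by rw [h2]⟩
    · exact Or.inr ⟨h1, by rw [h2]; exact LinearIsometryEquiv.ext fun x => rfl⟩
  have hdozen' : (FrB : E3 → E3) '' ↑fccSlots = ((Gf.trans basalMirror : E3 ≃ₗᵢ[ℝ] E3) : E3 → E3) '' ↑fccSlots := by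
    have e1 : (FrB : E3 → E3) = basalMirror ∘ (Fr ∘ H) := by rw [hFrB]; rfl
    have e2 : ((Gf.trans basalMirror : E3 ≃ₗᵢ[ℝ] E3) : E3 → E3) = basalMirror ∘ Gf := rfl
    have e3 : (fun x => Fr (basalMirror x)) = Fr ∘ basalMirror := rfl
    rw [e1, e2, Set.image_comp, Set.image_comp, Set.image_comp, hHD, hdozen, e3, Set.image_comp]
  -- the fcc plate re-presented by `FrB`
  have hrep := stacking_const_eq_of_dozen hσ₂ (L₂.trans basalMirror) (basalMirror s₂ + cM) (Gf.trans basalMirror) hGf' FrB hdozen'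
  have hP₂' : ∀ p, p ∈ P₂.image M ↔ (p ∈ stacking FrB (basalMirror s₂ + cM) constHagg ∧
      -(2 * R₀) ≤ p 2 ∧ p 2 ≤ -R₀ ∧ p 0 ^ 2 + p 1 ^ 2 ≤ ρ ^ 2) := by
    intro p
    have hmem : p ∈ P₂.image M ↔ M p ∈ P₂ := by
      rw [mem_image]
      constructor
      · rintro ⟨x, hx, hxp⟩; rw [← hxp, hMM]; exact hx
      · intro hp; exact ⟨M p, hp, hMM p⟩
    rw [hmem, hP₂, hM2, hMrad, hstack, hrep]
    constructor
    · rintro ⟨h1, h2, h3, h4⟩; exact ⟨h1, by linarith, by linarith, h4⟩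
    · rintro ⟨h1, h2, h3, h4⟩; exact ⟨h1, by linarith, by linarith, h4⟩
  obtain ⟨ψ', hψ', h0⟩ := oneFcc_srcB_ge FrB (basalMirror s₂ + cM) (P₂.image M) R₀ h ρ hR₀ hh hρ hP₂'
    ((L.symm s) 2 - zs * (L.symm (EuclideanSpace.single (2 : Fin 3) (1 : ℝ))) 2)
    ((zs + R₀ + 2) * (L.symm (EuclideanSpace.single (2 : Fin 3) (1 : ℝ))) 2) Kw
  refine ⟨ψ', hψ', ?_⟩
  -- the roots, rises and tilt of `FrB` are those of `Fr`
  rw [hFrB, hH] at h0 ⊢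
  rw [inPlaneRoots_frB hFrL] at h0 ⊢
  have hα : ∑ r ∈ inPlaneRoots Fr 1,
      (((((ℝ ∙ EuclideanSpace.single (2 : Fin 3) (1 : ℝ)).reflection).trans Fr).trans basalMirror) r) 2 =
      ∑ r ∈ inPlaneRoots Fr 1, (Fr r) 2 :=
    sum_congr rfl fun r hr => frB_apply_two hFrL (mem_filter.1 hr).2.1
  rw [hα, symm_e₃_two_sq_frB, symm_e₃_two_sq_frame hFr] at h0
  have hRT : ((inPlaneRoots Fr 1).card : ℝ) ≤ 12 := by
    have : (inPlaneRoots Fr 1).card ≤ 12 := (card_le_card (filter_subset _ _)).trans (by rw [card_fccSlots])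
    exact_mod_cast this
  have key : ∑ k ∈ Kw, (4 * (∑ r ∈ inPlaneRoots Fr 1, (Fr r) 2) /
            (Real.sqrt 3 * (1 - (L.symm (EuclideanSpace.single (2 : Fin 3) (1 : ℝ))) 2 ^ 2)) *
          Real.sqrt (max 0 ((ρ - 4) ^ 2 * (1 - (L.symm (EuclideanSpace.single (2 : Fin 3) (1 : ℝ))) 2 ^ 2) -
            ((L.symm s) 2 - zs * (L.symm (EuclideanSpace.single (2 : Fin 3) (1 : ℝ))) 2 + (k : ℝ) * Real.sqrt (2 / 3) + ψ') ^ 2)) - 3) =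
      ∑ k ∈ Kw, (4 * (∑ r ∈ inPlaneRoots Fr 1, (Fr r) 2) /
            (Real.sqrt 3 * (1 - (L.symm (EuclideanSpace.single (2 : Fin 3) (1 : ℝ))) 2 ^ 2)) *
          Real.sqrt (max 0 ((ρ - 4) ^ 2 * (1 - (L.symm (EuclideanSpace.single (2 : Fin 3) (1 : ℝ))) 2 ^ 2) -
            ((L.symm s) 2 - zs * (L.symm (EuclideanSpace.single (2 : Fin 3) (1 : ℝ))) 2 + (k : ℝ) * Real.sqrt (2 / 3) + ψ') ^ 2)) -
            ((inPlaneRoots Fr 1).card : ℝ)) +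
        (Kw.card : ℝ) * (((inPlaneRoots Fr 1).card : ℝ) - 3) := by
    have e : ∀ (x c : ℝ), x - 3 = (x - c) + (c - 3) := fun x c => by ring
    rw [sum_congr rfl fun k _ => e _ ((inPlaneRoots Fr 1).card : ℝ), sum_add_distrib, sum_const, nsmul_eq_mul]
  have hK0 : (0 : ℝ) ≤ (Kw.card : ℝ) := Nat.cast_nonneg _
  nlinarith [key, h0, hRT, hK0]

end Summit.Ventures.Crystal3D.Theorems

end
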